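import Mathlib
import Literature.NumberTheory.ModularForms.LevelTwoReduction
import HarnessLib

/-!
# Reduction theory for `Γ₀(3)⁺ = ⟨Γ₀(3), W₃⟩`: the fundamental domain `{|Re z| ≤ ½, |z|² ≥ ⅓}`

[topic NumberTheory/ModularForms]

The group generated by `Γ₀(3) ⊂ SL₂(ℤ)` (Mathlib's action on `ℍ`) and the Fricke involution
`W₃ : z ↦ −1/(3z)` (`frickeThree`) has the `SL₂(ℤ)`-shaped fundamental domain
`𝒟₃ = {|Re z| ≤ ½, |z|² ≥ ⅓}` with corners `∓½ + i√3/6` (the elliptic points of order `3` of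
`Γ₀(3)`; the right corner is `cmLevelThree = (3 + i√3)/6` of Zhou 2015, Remark 9). This is the
level-`3` companion of `LevelTwoReduction.lean` (whose level-free helpers `det_two_entries`,
`coe_smul_eq`, `denom_int_ne_zero`, `im_smul_eq`, `smul_eq_vadd_of_bottom_left_eq_zero` are reused), proving what the level-3 Green-function
construction needs:

* `frickeThree_smul`: `W₃(γ•z) = γ^{W}•(W₃ z)` with `γ^W = (d, −c/3; −3b, a) ∈ Γ₀(3)`
  (`frickeConjThree`), `frickeThree_frickeThree : W₃(W₃ z) = z`; the orbit `orbThree z` under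
  `Γ₀(3)⁺` and its stability;
* **`𝒟₃`-points have maximal height in their orbit** (`im_le_of_mem_fdThree`): for `u ∈ 𝒟₃`,
  `γ ∈ Γ₀(3)`: `Im(γ•u) ≤ Im u` (`|cu + d|² ≥ d² − 3|d||c/3| + 3(c/3)² ≥ 1`, an integer `≥ ¾`) and
  `Im(γ•W₃u) ≤ Im u` (`Im(γ W₃ u) = 3 Im u/|3du − c|²`, `|3du − c|² ≥ 3`), with the equality cases
  off the corners (`eq_vadd_of_im_eq`, `eq_vadd_fricke_of_im_eq`);
* points of `𝒟₃` have `Im² ≥ 1/12` with equality exactly at the corners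
  (`im_sq_ge_of_mem_fdThree`, `corner_of_im_sq_eq`);
* **existence of representatives** (`exists_mem_orbThree_mem_fdThree`).

## References
* Zhou 2015, Remark 9 (level `3`). [cite: Zhou2015, Remark 9]
* standard reduction theory for Fricke groups. [folklore]
-/

noncomputable section

open Complex hiding I
open UpperHalfPlane hiding I
open Filter Topology CongruenceSubgroup
open scoped MatrixGroups ModularForm

namespace Literature.NumberTheory.ModularForms

/-! ## The Fricke involution `W₃` and `Γ₀(3)` -/

/-- The Fricke involution `W₃ τ = −1/(3τ)`. [folklore] -/
def frickeThree (τ : ℍ) : ℍ :=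
  UpperHalfPlane.mk (-((⟨3 * (τ : ℂ), by simpa using τ.im_pos⟩ : ℍ) : ℂ))⁻¹
    (UpperHalfPlane.im_inv_neg_coe_pos _)

/-- Coordinate of `W₃ τ`. [folklore] -/
theorem coe_frickeThree (τ : ℍ) : ((frickeThree τ : ℍ) : ℂ) = -1 / (3 * (τ : ℂ)) := by
  show (-(3 * (τ : ℂ)))⁻¹ = -1 / (3 * (τ : ℂ))
  rw [inv_neg, neg_div, one_div]

/-- `γ ∈ Γ₀(3) ↔ 3 ∣ c`. [folklore] -/
theorem mem_Gamma0_three_iff (γ : SL(2, ℤ)) : γ ∈ Gamma0 3 ↔ (3 : ℤ) ∣ γ 1 0 := by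
  rw [Gamma0_mem]
  exact ZMod.intCast_zmod_eq_zero_iff_dvd _ 3

/-- **The Fricke conjugate** `γ^W := W₃ γ W₃⁻¹ = (d, −c/3; −3b, a)` of `γ ∈ Γ₀(3)`. [folklore] -/
def frickeConjThree (γ : SL(2, ℤ)) (hγ : γ ∈ Gamma0 3) : SL(2, ℤ) :=
  ⟨!![γ 1 1, -(γ 1 0 / 3); -(3 * γ 0 1), γ 0 0], by
    obtain ⟨k, hk⟩ := (mem_Gamma0_three_iff γ).mp hγ
    have hdet := det_two_entries γ
    rw [Matrix.det_fin_two_of, hk, Int.mul_ediv_cancel_left _ (by norm_num : (3 : ℤ) ≠ 0)]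
    rw [hk] at hdet
    linarith⟩

/-- `γ^W ∈ Γ₀(3)`. [folklore] -/
theorem frickeConjThree_mem (γ : SL(2, ℤ)) (hγ : γ ∈ Gamma0 3) : frickeConjThree γ hγ ∈ Gamma0 3 := by
  rw [mem_Gamma0_three_iff]
  show (3 : ℤ) ∣ (!![γ 1 1, -(γ 1 0 / 3); -(3 * γ 0 1), γ 0 0] : Matrix (Fin 2) (Fin 2) ℤ) 1 0
  simp

/-- `W₃ ∘ W₃ = id`. [folklore] -/
theorem frickeThree_frickeThree (z : ℍ) : frickeThree (frickeThree z) = z := by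
  apply UpperHalfPlane.ext
  rw [coe_frickeThree, coe_frickeThree]
  have hz : (z : ℂ) ≠ 0 := z.ne_zero
  field_simp

/-- `Im W₃ z = Im z/(3|z|²)`. [folklore] -/
theorem im_frickeThree (z : ℍ) : (frickeThree z).im = z.im / (3 * Complex.normSq (z : ℂ)) := by
  rw [← UpperHalfPlane.coe_im, coe_frickeThree, Complex.div_im, Complex.neg_im, Complex.one_im,
    Complex.neg_re, Complex.one_re]
  simp [Complex.normSq_mul]
  ring

/-- Entries of `γ^W`. [folklore] -/
theorem frickeConjThree_entries (γ : SL(2, ℤ)) (hγ : γ ∈ Gamma0 3) :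
    (frickeConjThree γ hγ) 0 0 = γ 1 1 ∧ (frickeConjThree γ hγ) 0 1 = -(γ 1 0 / 3) ∧
      (frickeConjThree γ hγ) 1 0 = -(3 * γ 0 1) ∧ (frickeConjThree γ hγ) 1 1 = γ 0 0 := by
  refine ⟨?_, ?_, ?_, ?_⟩ <;>
    · show (!![γ 1 1, -(γ 1 0 / 3); -(3 * γ 0 1), γ 0 0] : Matrix (Fin 2) (Fin 2) ℤ) _ _ = _; simp

/-- **`W₃(γ•z) = γ^W • W₃ z`** for `γ ∈ Γ₀(3)`. [folklore] -/
theorem frickeThree_smul (γ : SL(2, ℤ)) (hγ : γ ∈ Gamma0 3) (z : ℍ) :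
    frickeThree (γ • z) = frickeConjThree γ hγ • frickeThree z := by
  obtain ⟨k, hk⟩ := (mem_Gamma0_three_iff γ).mp hγ
  obtain ⟨e00, e01, e10, e11⟩ := frickeConjThree_entries γ hγ
  have hz : (z : ℂ) ≠ 0 := z.ne_zero
  have hden := denom_int_ne_zero γ z
  have hnum : ((γ 0 0 : ℤ) : ℂ) * z + ((γ 0 1 : ℤ) : ℂ) ≠ 0 := by
    intro h0
    have : ((γ • z : ℍ) : ℂ) = 0 := by rw [coe_smul_eq, h0, zero_div]
    exact (γ • z).ne_zero this
  have hL : ((frickeThree (γ • z) : ℍ) : ℂ) =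
      -(((γ 1 0 : ℤ) : ℂ) * z + ((γ 1 1 : ℤ) : ℂ)) / (3 * (((γ 0 0 : ℤ) : ℂ) * z + ((γ 0 1 : ℤ) : ℂ))) := by
    rw [coe_frickeThree, coe_smul_eq]
    field_simp
  have hR : ((frickeConjThree γ hγ • frickeThree z : ℍ) : ℂ) =
      -(((γ 1 0 : ℤ) : ℂ) * z + ((γ 1 1 : ℤ) : ℂ)) / (3 * (((γ 0 0 : ℤ) : ℂ) * z + ((γ 0 1 : ℤ) : ℂ))) := by
    rw [coe_smul_eq, e00, e01, e10, e11, coe_frickeThree, hk,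
      Int.mul_ediv_cancel_left _ (by norm_num : (3 : ℤ) ≠ 0)]
    push_cast
    rw [div_eq_div_iff ?_ (mul_ne_zero three_ne_zero hnum)]
    · field_simp
      ring
    · rw [show -(3 * ((γ 0 1 : ℤ) : ℂ)) * (-1 / (3 * (z : ℂ))) + ((γ 0 0 : ℤ) : ℂ) =
        (((γ 0 0 : ℤ) : ℂ) * z + ((γ 0 1 : ℤ) : ℂ)) / z by field_simp; ring]
      exact div_ne_zero hnum hz
  exact UpperHalfPlane.ext (hL.trans hR.symm)

/-! ## The orbit under `Γ₀(3)⁺` -/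

/-- The `Γ₀(3)⁺`-orbit of `z`: the points `γ•z` and `γ•W₃z`, `γ ∈ Γ₀(3)`. [folklore] -/
def orbThree (z : ℍ) : Set ℍ := {u | ∃ γ : SL(2, ℤ), γ ∈ Gamma0 3 ∧ (u = γ • z ∨ u = γ • frickeThree z)}

/-- `z ∈ orbThree z`. [folklore] -/
theorem mem_orbThree_self (z : ℍ) : z ∈ orbThree z := ⟨1, Subgroup.one_mem _, Or.inl (one_smul _ _).symm⟩

/-- `W₃ z ∈ orbThree z`. [folklore] -/
theorem frickeThree_mem_orbThree (z : ℍ) : frickeThree z ∈ orbThree z :=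
  ⟨1, Subgroup.one_mem _, Or.inr (one_smul _ _).symm⟩

/-- `γ • z ∈ orbThree z`. [folklore] -/
theorem smul_mem_orbThree {γ : SL(2, ℤ)} (hγ : γ ∈ Gamma0 3) (z : ℍ) : γ • z ∈ orbThree z :=
  ⟨γ, hγ, Or.inl rfl⟩

/-- Transitivity: the orbit of an orbit point is contained in the orbit. [folklore] -/
theorem orbThree_subset_of_mem {z u : ℍ} (hu : u ∈ orbThree z) : orbThree u ⊆ orbThree z := by
  obtain ⟨γ, hγ, hu⟩ := hu
  rintro v ⟨δ, hδ, hv⟩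
  rcases hu with rfl | rfl <;> rcases hv with rfl | rfl
  · exact ⟨δ * γ, Subgroup.mul_mem _ hδ hγ, Or.inl (mul_smul _ _ _).symm⟩
  · refine ⟨δ * frickeConjThree γ hγ, Subgroup.mul_mem _ hδ (frickeConjThree_mem γ hγ), Or.inr ?_⟩
    rw [mul_smul, frickeThree_smul]
  · exact ⟨δ * γ, Subgroup.mul_mem _ hδ hγ, Or.inr (mul_smul _ _ _).symm⟩
  · refine ⟨δ * frickeConjThree γ hγ, Subgroup.mul_mem _ hδ (frickeConjThree_mem γ hγ), Or.inl ?_⟩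
    rw [mul_smul, frickeThree_smul, frickeThree_frickeThree]

/-- Symmetry of the orbit relation. [folklore] -/
theorem mem_orbThree_symm {z u : ℍ} (hu : u ∈ orbThree z) : z ∈ orbThree u := by
  obtain ⟨γ, hγ, hu⟩ := hu
  rcases hu with rfl | rfl
  · exact ⟨γ⁻¹, Subgroup.inv_mem _ hγ, Or.inl (by rw [inv_smul_smul])⟩
  · have hγ' : γ⁻¹ ∈ Gamma0 3 := Subgroup.inv_mem _ hγ
    refine ⟨frickeConjThree γ⁻¹ hγ', frickeConjThree_mem _ hγ', Or.inr ?_⟩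
    rw [← frickeThree_smul, inv_smul_smul, frickeThree_frickeThree]

/-- **Orbits of equivalent points coincide.** [folklore] -/
theorem orbThree_eq_of_mem {z u : ℍ} (hu : u ∈ orbThree z) : orbThree u = orbThree z :=
  Set.Subset.antisymm (orbThree_subset_of_mem hu) (orbThree_subset_of_mem (mem_orbThree_symm hu))

/-- The orbit is `Γ₀(3)`-stable. [folklore] -/
theorem orbThree_smul {γ : SL(2, ℤ)} (hγ : γ ∈ Gamma0 3) (z : ℍ) : orbThree (γ • z) = orbThree z :=
  orbThree_eq_of_mem (smul_mem_orbThree hγ z)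

/-- The orbit is `W₃`-stable. [folklore] -/
theorem orbThree_frickeThree (z : ℍ) : orbThree (frickeThree z) = orbThree z :=
  orbThree_eq_of_mem (frickeThree_mem_orbThree z)

/-! ## The fundamental domain `𝒟₃` -/

/-- `𝒟₃ := {|Re z| ≤ ½, |z|² ≥ ⅓}`. [folklore] -/
def fdThree : Set ℍ := {u | |u.re| ≤ 1 / 2 ∧ 1 / 3 ≤ Complex.normSq (u : ℂ)}

/-- Points of `𝒟₃` have `Im² ≥ 1/12`. [folklore] -/
theorem im_sq_ge_of_mem_fdThree {u : ℍ} (hu : u ∈ fdThree) : 1 / 12 ≤ u.im ^ 2 := by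
  obtain ⟨hre, hn⟩ := hu
  rw [Complex.normSq_apply, UpperHalfPlane.coe_re, UpperHalfPlane.coe_im] at hn
  have h1 : u.re * u.re ≤ 1 / 4 := by
    have := abs_le.mp hre; nlinarith
  nlinarith

/-- In `𝒟₃`, `Im² u = 1/12` forces `|Re u| = ½` and `|u|² = ⅓` (a corner). [folklore] -/
theorem corner_of_im_sq_eq {u : ℍ} (hu : u ∈ fdThree) (h : u.im ^ 2 = 1 / 12) :
    (u.re = 1 / 2 ∨ u.re = -(1 / 2)) ∧ Complex.normSq (u : ℂ) = 1 / 3 := by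
  obtain ⟨hre, hn⟩ := hu
  rw [Complex.normSq_apply, UpperHalfPlane.coe_re, UpperHalfPlane.coe_im] at hn ⊢
  have h1 : u.re * u.re ≤ 1 / 4 := by
    have := abs_le.mp hre; nlinarith
  have h2 : u.re * u.re = 1 / 4 := by nlinarith
  refine ⟨?_, by nlinarith⟩
  have : (u.re - 1 / 2) * (u.re + 1 / 2) = 0 := by nlinarith
  rcases mul_eq_zero.mp this with h0 | h0
  · left; linarith
  · right; linarith

/-- The non-corner condition `Im² > 1/12` means `|Re u| < ½` or `|u|² > ⅓`. [folklore] -/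
theorem re_lt_or_normSq_gt {u : ℍ} (hu : u ∈ fdThree) (hcorner : 1 / 12 < u.im ^ 2) :
    |u.re| < 1 / 2 ∨ 1 / 3 < Complex.normSq (u : ℂ) := by
  by_contra hcon
  push Not at hcon
  obtain ⟨h1, h2⟩ := hcon
  have hre : |u.re| = 1 / 2 := le_antisymm hu.1 h1
  have hn : Complex.normSq (u : ℂ) = 1 / 3 := le_antisymm h2 hu.2
  rw [Complex.normSq_apply, UpperHalfPlane.coe_re, UpperHalfPlane.coe_im] at hn
  have : u.re ^ 2 = 1 / 4 := by rw [← sq_abs, hre]; norm_num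
  nlinarith

/-! ## The integer quadratic form `d² − 3|d||k| + 3k²` -/

/-- For integers `(d, k) ≠ (0, 0)`: `d² − 3|d||k| + 3k² ≥ 1` (for `k ≠ 0` it is an integer with
`4(d² − 3|d||k| + 3k²) = (2|d| − 3|k|)² + 3k² ≥ 3`; for `k = 0` it is `d² ≥ 1`). [folklore] -/
theorem quadForm_ge_one (d k : ℤ) (hk : d ≠ 0 ∨ k ≠ 0) : 1 ≤ d ^ 2 - 3 * |d| * |k| + 3 * k ^ 2 := by
  rcases eq_or_ne k 0 with rfl | hk0
  · have hd : d ≠ 0 := hk.resolve_right (by simp)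
    simp
    nlinarith [Int.one_le_abs hd, sq_abs d]
  · have h1 : (1 : ℤ) ≤ k ^ 2 := by nlinarith [Int.one_le_abs hk0, sq_abs k]
    have h4 : 3 ≤ 4 * (d ^ 2 - 3 * |d| * |k| + 3 * k ^ 2) := by
      nlinarith [sq_nonneg (2 * |d| - 3 * |k|), sq_abs d, sq_abs k]
    linarith

/-- The same in real form. [folklore] -/
theorem quadForm_ge_one_real (d k : ℤ) (hk : d ≠ 0 ∨ k ≠ 0) :
    (1 : ℝ) ≤ (d : ℝ) ^ 2 - 3 * |(d : ℝ)| * |(k : ℝ)| + 3 * (k : ℝ) ^ 2 := by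
  have h := quadForm_ge_one d k hk
  have : ((1 : ℤ) : ℝ) ≤ ((d ^ 2 - 3 * |d| * |k| + 3 * k ^ 2 : ℤ) : ℝ) := by exact_mod_cast h
  push_cast at this
  exact this

/-! ## Heights in the orbit: `𝒟₃`-points are maximal -/

/-- Height of `γ•W₃u`: `Im(γ W₃ u) = 3 Im u/|3d u − c|²`. [folklore] -/
theorem im_smul_frickeThree_eq (γ : SL(2, ℤ)) (u : ℍ) :
    (γ • frickeThree u).im = 3 * u.im / Complex.normSq (3 * ((γ 1 1 : ℤ) : ℂ) * u - ((γ 1 0 : ℤ) : ℂ)) := by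
  rw [im_smul_eq, im_frickeThree]
  have hu : (u : ℂ) ≠ 0 := u.ne_zero
  have hden := denom_int_ne_zero γ (frickeThree u)
  rw [coe_frickeThree] at hden ⊢
  have e : ((γ 1 0 : ℤ) : ℂ) * (-1 / (3 * (u : ℂ))) + ((γ 1 1 : ℤ) : ℂ) =
      (3 * ((γ 1 1 : ℤ) : ℂ) * u - ((γ 1 0 : ℤ) : ℂ)) / (3 * u) := by
    field_simp; ring
  rw [e, Complex.normSq_div, Complex.normSq_mul]
  have hn : Complex.normSq (u : ℂ) ≠ 0 := by rwa [Ne, Complex.normSq_eq_zero]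
  have hN : Complex.normSq (3 * ((γ 1 1 : ℤ) : ℂ) * u - ((γ 1 0 : ℤ) : ℂ)) ≠ 0 := by
    intro h0
    rw [Complex.normSq_eq_zero] at h0
    apply hden; rw [e, h0, zero_div]
  simp [Complex.normSq_ofNat]
  field_simp

/-- **The basic estimate.** For `u ∈ 𝒟₃` and integers `d, k`:
`|3k u + d|² ≥ d² − 3|d||k| + 3k²`. [folklore] -/
theorem normSq_denom_ge_quadForm {u : ℍ} (hu : u ∈ fdThree) (d k : ℤ) :
    (d : ℝ) ^ 2 - 3 * |(d : ℝ)| * |(k : ℝ)| + 3 * (k : ℝ) ^ 2 ≤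
      Complex.normSq (((3 * k : ℤ) : ℂ) * u + (d : ℂ)) := by
  obtain ⟨hre, hn⟩ := hu
  rw [Complex.normSq_apply, UpperHalfPlane.coe_re, UpperHalfPlane.coe_im] at hn
  rw [Complex.normSq_apply]
  simp only [Complex.add_re, Complex.mul_re, Complex.intCast_re, Complex.intCast_im, zero_mul,
    sub_zero, UpperHalfPlane.coe_re, UpperHalfPlane.coe_im, Complex.add_im, Complex.mul_im, add_zero]
  push_cast
  have hre' := abs_le.mp hre
  -- `6kd·Re u ≥ −3|dk|`
  have hB : -(3 * |(d : ℝ)| * |(k : ℝ)|) ≤ 6 * (k : ℝ) * d * u.re := by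
    have : |6 * (k : ℝ) * d * u.re| ≤ 3 * |(d : ℝ)| * |(k : ℝ)| := by
      rw [show 6 * (k : ℝ) * d * u.re = ((d : ℝ) * k) * (6 * u.re) by ring, abs_mul, abs_mul]
      have : |6 * u.re| ≤ 3 := by rw [abs_le]; constructor <;> linarith
      nlinarith [abs_nonneg (d : ℝ), abs_nonneg (k : ℝ), mul_nonneg (abs_nonneg (d : ℝ)) (abs_nonneg (k : ℝ))]
    linarith [neg_abs_le (6 * (k : ℝ) * d * u.re)]
  nlinarith [sq_nonneg (k : ℝ)]

/-- `d ≠ 0` for `γ ∈ Γ₀(3)`. [folklore] -/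
theorem bottom_right_ne_zero (γ : SL(2, ℤ)) (hγ : γ ∈ Gamma0 3) : γ 1 1 ≠ 0 := by
  intro hd
  obtain ⟨k, hk⟩ := (mem_Gamma0_three_iff γ).mp hγ
  have hdet := det_two_entries γ
  rw [hd, hk] at hdet
  have : (3 : ℤ) ∣ 1 := ⟨-(γ 0 1 * k), by linarith⟩
  norm_num at this

/-- `|cu + d|² ≥ 1` for `u ∈ 𝒟₃`, `3 ∣ c`, `(c, d)` a bottom row. [folklore] -/
theorem one_le_normSq_denom_three {u : ℍ} (hu : u ∈ fdThree) (γ : SL(2, ℤ)) (hγ : γ ∈ Gamma0 3) :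
    1 ≤ Complex.normSq (((γ 1 0 : ℤ) : ℂ) * u + ((γ 1 1 : ℤ) : ℂ)) := by
  obtain ⟨k, hk⟩ := (mem_Gamma0_three_iff γ).mp hγ
  have hdet := det_two_entries γ
  have h := normSq_denom_ge_quadForm hu (γ 1 1) k
  rw [hk]
  exact (quadForm_ge_one_real (γ 1 1) k (Or.inl (bottom_right_ne_zero γ hγ))).trans h

/-- The Fricke estimate: for `u ∈ 𝒟₃` and integers `d, k`:
`|3d u − 3k|² = 9|du − k|² ≥ 3(d² − 3|d||k| + 3k²)`. [folklore] -/
theorem normSq_fricke_ge_quadForm {u : ℍ} (hu : u ∈ fdThree) (d k : ℤ) :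
    3 * ((d : ℝ) ^ 2 - 3 * |(d : ℝ)| * |(k : ℝ)| + 3 * (k : ℝ) ^ 2) ≤
      Complex.normSq (3 * (d : ℂ) * u - ((3 * k : ℤ) : ℂ)) := by
  obtain ⟨hre, hn⟩ := hu
  have hn' := hn
  rw [Complex.normSq_apply, UpperHalfPlane.coe_re, UpperHalfPlane.coe_im] at hn'
  rw [Complex.normSq_apply]
  simp only [Complex.sub_re, Complex.mul_re, Complex.intCast_re, Complex.intCast_im, Complex.re_ofNat,
    Complex.im_ofNat, zero_mul, sub_zero, UpperHalfPlane.coe_re, UpperHalfPlane.coe_im,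
    Complex.sub_im, Complex.mul_im, add_zero, mul_zero]
  push_cast
  have hre' := abs_le.mp hre
  have hB : -(3 * |(d : ℝ)| * |(k : ℝ)|) ≤ -(6 * (d : ℝ) * k * u.re) := by
    have : |6 * (d : ℝ) * k * u.re| ≤ 3 * |(d : ℝ)| * |(k : ℝ)| := by
      rw [show 6 * (d : ℝ) * k * u.re = ((d : ℝ) * k) * (6 * u.re) by ring, abs_mul, abs_mul]
      have : |6 * u.re| ≤ 3 := by rw [abs_le]; constructor <;> linarith
      nlinarith [abs_nonneg (d : ℝ), abs_nonneg (k : ℝ), mul_nonneg (abs_nonneg (d : ℝ)) (abs_nonneg (k : ℝ))]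
    linarith [le_abs_self (6 * (d : ℝ) * k * u.re)]
  -- `9(d²(x²+y²) − 2dkx + k²) ≥ 3d² − 18dkx + 9k² ≥ 3d² − 9|dk| + 9k²`
  have hA : 3 * (d : ℝ) ^ 2 ≤ 9 * (d : ℝ) ^ 2 * (u.re * u.re + u.im * u.im) := by nlinarith [sq_nonneg (d : ℝ)]
  nlinarith

/-- `|3du − c|² ≥ 3` for `u ∈ 𝒟₃`, `3 ∣ c`, `(c, d)` a bottom row. [folklore] -/
theorem three_le_normSq_fricke_denom {u : ℍ} (hu : u ∈ fdThree) (γ : SL(2, ℤ)) (hγ : γ ∈ Gamma0 3) :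
    3 ≤ Complex.normSq (3 * ((γ 1 1 : ℤ) : ℂ) * u - ((γ 1 0 : ℤ) : ℂ)) := by
  obtain ⟨k, hk⟩ := (mem_Gamma0_three_iff γ).mp hγ
  have hd0 := bottom_right_ne_zero γ hγ
  have h := normSq_fricke_ge_quadForm hu (γ 1 1) k
  rw [hk]
  have hq := quadForm_ge_one_real (γ 1 1) k (Or.inl hd0)
  linarith

/-- **Heights in the orbit are bounded by the height of a `𝒟₃`-representative.** [folklore] -/
theorem im_le_of_mem_fdThree {u : ℍ} (hu : u ∈ fdThree) (γ : SL(2, ℤ)) (hγ : γ ∈ Gamma0 3) :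
    (γ • u).im ≤ u.im ∧ (γ • frickeThree u).im ≤ u.im := by
  constructor
  · rw [im_smul_eq]
    exact div_le_self u.im_pos.le (one_le_normSq_denom_three hu γ hγ)
  · rw [im_smul_frickeThree_eq, div_le_iff₀ (lt_of_lt_of_le three_pos (three_le_normSq_fricke_denom hu γ hγ))]
    nlinarith [three_le_normSq_fricke_denom hu γ hγ, u.im_pos]

/-- Every point of the orbit of a `𝒟₃`-point has smaller height. [folklore] -/
theorem im_le_of_mem_orbThree {u v : ℍ} (hu : u ∈ fdThree) (hv : v ∈ orbThree u) : v.im ≤ u.im := by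
  obtain ⟨γ, hγ, hv⟩ := hv
  rcases hv with rfl | rfl
  · exact (im_le_of_mem_fdThree hu γ hγ).1
  · exact (im_le_of_mem_fdThree hu γ hγ).2

/-! ## Equality cases off the corners -/

/-- **Strict estimate off the corners.** For `u ∈ 𝒟₃` with `Im² u > 1/12`, `k ≠ 0` and any `d ≠ 0`:
`|3k u + d|² > d² − 3|d||k| + 3k²`. [folklore] -/
theorem normSq_denom_gt_quadForm {u : ℍ} (hu : u ∈ fdThree) (hcorner : 1 / 12 < u.im ^ 2)
    {d k : ℤ} (hd : d ≠ 0) (hk : k ≠ 0) :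
    (d : ℝ) ^ 2 - 3 * |(d : ℝ)| * |(k : ℝ)| + 3 * (k : ℝ) ^ 2 <
      Complex.normSq (((3 * k : ℤ) : ℂ) * u + (d : ℂ)) := by
  have hcases := re_lt_or_normSq_gt hu hcorner
  obtain ⟨hre, hn⟩ := hu
  rw [Complex.normSq_apply, UpperHalfPlane.coe_re, UpperHalfPlane.coe_im] at hn hcases
  rw [Complex.normSq_apply]
  simp only [Complex.add_re, Complex.mul_re, Complex.intCast_re, Complex.intCast_im, zero_mul,
    sub_zero, UpperHalfPlane.coe_re, UpperHalfPlane.coe_im, Complex.add_im, Complex.mul_im, add_zero]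
  push_cast
  have hre' := abs_le.mp hre
  have hk1 : (1 : ℝ) ≤ (k : ℝ) ^ 2 := by
    have : (1 : ℤ) ≤ k ^ 2 := by nlinarith [Int.one_le_abs hk, sq_abs k]
    exact_mod_cast this
  have hdk : 0 < |(d : ℝ)| * |(k : ℝ)| := by
    apply mul_pos <;> rw [abs_pos] <;> exact_mod_cast (by assumption)
  have hBw : |6 * (k : ℝ) * d * u.re| ≤ 3 * |(d : ℝ)| * |(k : ℝ)| := by
    rw [show 6 * (k : ℝ) * d * u.re = ((d : ℝ) * k) * (6 * u.re) by ring, abs_mul, abs_mul]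
    have : |6 * u.re| ≤ 3 := by rw [abs_le]; constructor <;> linarith
    nlinarith [abs_nonneg (d : ℝ), abs_nonneg (k : ℝ), mul_nonneg (abs_nonneg (d : ℝ)) (abs_nonneg (k : ℝ))]
  rcases hcases with hlt | hgt
  · -- `|Re u| < 1/2`: the linear term is strictly better than `−3|dk|`
    have hlt' := abs_lt.mp hlt
    have hB : -(3 * |(d : ℝ)| * |(k : ℝ)|) < 6 * (k : ℝ) * d * u.re := by
      have : |6 * (k : ℝ) * d * u.re| < 3 * |(d : ℝ)| * |(k : ℝ)| := by
        rw [show 6 * (k : ℝ) * d * u.re = ((d : ℝ) * k) * (6 * u.re) by ring, abs_mul, abs_mul]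
        have h6 : |6 * u.re| < 3 := by rw [abs_lt]; constructor <;> linarith
        have := mul_lt_mul_of_pos_left h6 hdk
        nlinarith [abs_nonneg (d : ℝ), abs_nonneg (k : ℝ)]
      linarith [neg_abs_le (6 * (k : ℝ) * d * u.re)]
    nlinarith [sq_nonneg (k : ℝ)]
  · -- `|u|² > 1/3`: the quadratic term is strictly better
    have hB : -(3 * |(d : ℝ)| * |(k : ℝ)|) ≤ 6 * (k : ℝ) * d * u.re := by
      linarith [neg_abs_le (6 * (k : ℝ) * d * u.re)]
    nlinarith

/-- **Equality case I**: `u ∈ 𝒟₃` with `Im² u > 1/12` and `Im(γ•u) = Im u` force `γ•u = u + n`.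
[folklore] -/
theorem eq_vadd_of_im_eq_three {u : ℍ} (hu : u ∈ fdThree) (hcorner : 1 / 12 < u.im ^ 2) (γ : SL(2, ℤ))
    (hγ : γ ∈ Gamma0 3) (h : (γ • u).im = u.im) : ∃ n : ℤ, γ • u = ((n : ℝ)) +ᵥ u := by
  apply smul_eq_vadd_of_bottom_left_eq_zero
  by_contra hc
  obtain ⟨k, hk⟩ := (mem_Gamma0_three_iff γ).mp hγ
  have hk0 : k ≠ 0 := by rintro rfl; simp at hk; exact hc hk
  have hd0 := bottom_right_ne_zero γ hγ
  rw [im_smul_eq, div_eq_iff (by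
    have := one_le_normSq_denom_three hu γ hγ; linarith), eq_comm, mul_eq_left₀ u.im_pos.ne'] at h
  have hgt := normSq_denom_gt_quadForm hu hcorner hd0 hk0
  have hq := quadForm_ge_one_real (γ 1 1) k (Or.inr hk0)
  rw [← hk] at hgt
  linarith

/-- **Equality case II**: `u ∈ 𝒟₃` with `Im² u > 1/12` and `Im(γ•W₃u) = Im u` force `|u|² = ⅓` and
`γ•W₃u = W₃u + n`. [folklore] -/
theorem eq_vadd_fricke_of_im_eq_three {u : ℍ} (hu : u ∈ fdThree) (hcorner : 1 / 12 < u.im ^ 2) (γ : SL(2, ℤ))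
    (hγ : γ ∈ Gamma0 3) (h : (γ • frickeThree u).im = u.im) :
    Complex.normSq (u : ℂ) = 1 / 3 ∧ ∃ n : ℤ, γ • frickeThree u = ((n : ℝ)) +ᵥ frickeThree u := by
  have hcases := re_lt_or_normSq_gt hu hcorner
  obtain ⟨hre, hn⟩ := hu
  obtain ⟨k, hk⟩ := (mem_Gamma0_three_iff γ).mp hγ
  have hdet := det_two_entries γ
  have hd0 := bottom_right_ne_zero γ hγ
  rw [hk] at hdet
  have h3 := three_le_normSq_fricke_denom ⟨hre, hn⟩ γ hγ
  rw [im_smul_frickeThree_eq, div_eq_iff (by linarith), eq_comm] at h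
  have hN : Complex.normSq (3 * ((γ 1 1 : ℤ) : ℂ) * u - ((γ 1 0 : ℤ) : ℂ)) = 3 := by
    nlinarith [u.im_pos]
  set d : ℤ := γ 1 1 with hd
  -- expand `|3du − 3k|²`
  have e : Complex.normSq (3 * (d : ℂ) * u - ((γ 1 0 : ℤ) : ℂ)) =
      9 * ((d : ℝ) ^ 2 * Complex.normSq (u : ℂ) - 2 * (d : ℝ) * k * u.re + (k : ℝ) ^ 2) := by
    rw [hk, Complex.normSq_apply, Complex.normSq_apply]
    simp only [Complex.sub_re, Complex.mul_re, Complex.intCast_re, Complex.intCast_im, Complex.re_ofNat,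
      Complex.im_ofNat, zero_mul, sub_zero, UpperHalfPlane.coe_re, UpperHalfPlane.coe_im,
      Complex.sub_im, Complex.mul_im, add_zero, mul_zero]
    push_cast; ring
  rw [e] at hN
  have hre' := abs_le.mp hre
  have hd1 : (1 : ℝ) ≤ (d : ℝ) ^ 2 := by
    have : (1 : ℤ) ≤ d ^ 2 := by nlinarith [Int.one_le_abs hd0, sq_abs d]
    exact_mod_cast this
  -- the value `d²|u|² − 2dk Re u + k² = 1/3`; lower bound `d²/3 − |dk| + k² ≥ (k² − 3|k||d| + 3d²)/3 ≥ 1/3`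
  have hval : (d : ℝ) ^ 2 * Complex.normSq (u : ℂ) - 2 * (d : ℝ) * k * u.re + (k : ℝ) ^ 2 = 1 / 3 := by
    linarith
  have hBw : |2 * (d : ℝ) * k * u.re| ≤ |(d : ℝ)| * |(k : ℝ)| := by
    rw [show 2 * (d : ℝ) * k * u.re = ((d : ℝ) * k) * (2 * u.re) by ring, abs_mul, abs_mul]
    have : |2 * u.re| ≤ 1 := by rw [abs_le]; constructor <;> linarith
    nlinarith [abs_nonneg (d : ℝ), abs_nonneg (k : ℝ), mul_nonneg (abs_nonneg (d : ℝ)) (abs_nonneg (k : ℝ))]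
  -- `k = 0`
  have hk0 : k = 0 := by
    by_contra hk0
    have hq := quadForm_ge_one_real d k (Or.inr hk0)
    -- lower bound `≥ 1/3` with equality forcing `|u|² = 1/3` and `2dk Re u = |dk|`, a corner
    have hA : (d : ℝ) ^ 2 / 3 ≤ (d : ℝ) ^ 2 * Complex.normSq (u : ℂ) := by nlinarith [sq_nonneg (d : ℝ)]
    have hB : 2 * (d : ℝ) * k * u.re ≤ |(d : ℝ)| * |(k : ℝ)| := by
      linarith [le_abs_self (2 * (d : ℝ) * k * u.re)]
    have hQ : (1 : ℝ) / 3 ≤ (d : ℝ) ^ 2 / 3 - |(d : ℝ)| * |(k : ℝ)| + (k : ℝ) ^ 2 := by linarith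
    -- so all inequalities are tight
    have hA0 : (d : ℝ) ^ 2 * Complex.normSq (u : ℂ) = (d : ℝ) ^ 2 / 3 := by linarith
    have hB0 : 2 * (d : ℝ) * k * u.re = |(d : ℝ)| * |(k : ℝ)| := by linarith
    have hns : Complex.normSq (u : ℂ) = 1 / 3 := by
      have : (d : ℝ) ^ 2 * (Complex.normSq (u : ℂ) - 1 / 3) = 0 := by linarith
      rcases mul_eq_zero.mp this with h0 | h0
      · nlinarith
      · linarith
    have hdk : 0 < |(d : ℝ)| * |(k : ℝ)| := by
      apply mul_pos <;> rw [abs_pos] <;> exact_mod_cast (by assumption)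
    have hre2 : |u.re| = 1 / 2 := by
      have h1 : |2 * (d : ℝ) * k * u.re| = |(d : ℝ)| * |(k : ℝ)| := by
        rw [hB0, abs_of_pos hdk]
      rw [show 2 * (d : ℝ) * k * u.re = ((d : ℝ) * k) * (2 * u.re) by ring, abs_mul, abs_mul] at h1
      have h2 : |2 * u.re| = 1 := by
        have := mul_left_cancel₀ hdk.ne' (h1.trans (mul_one _).symm)
        exact this
      rw [abs_mul, abs_two] at h2
      linarith
    rcases hcases with hlt | hgt
    · linarith
    · linarith
  -- `k = 0`: translation and `|u|² = 1/3`
  have hc : γ 1 0 = 0 := by rw [hk, hk0]; ring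
  rw [hk0] at hdet hval; simp at hdet
  have hd2 : (d : ℝ) ^ 2 = 1 := by
    rcases Int.eq_one_or_neg_one_of_mul_eq_one' hdet with ⟨-, h⟩ | ⟨-, h⟩ <;>
      · have : d = _ := h; rw [this]; norm_num
  push_cast at hval
  rw [hd2] at hval
  refine ⟨by nlinarith, ?_⟩
  exact smul_eq_vadd_of_bottom_left_eq_zero γ hc _

/-! ## Existence of representatives -/

/-- Heights are maximised over `Γ₀(3)`. [folklore] -/
theorem exists_max_im_Gamma0_three (z : ℍ) :
    ∃ g : SL(2, ℤ), g ∈ Gamma0 3 ∧ ∀ g' : SL(2, ℤ), g' ∈ Gamma0 3 → (g' • z).im ≤ (g • z).im := by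
  classical
  let s : Set (Fin 2 → ℤ) := {cd | IsCoprime (cd 0) (cd 1) ∧ (3 : ℤ) ∣ cd 0}
  have hs : s.Nonempty := ⟨![0, 1], by simp [s, isCoprime_one_right]⟩
  obtain ⟨p, ⟨hp_coprime, hp3⟩, hp⟩ :=
    Filter.Tendsto.exists_within_forall_le hs (ModularGroup.tendsto_normSq_coprime_pair z)
  obtain ⟨g, -, hg⟩ := ModularGroup.bottom_row_surj hp_coprime
  have hg3 : g ∈ Gamma0 3 := by
    rw [mem_Gamma0_three_iff]
    have : (g : Matrix (Fin 2) (Fin 2) ℤ) 1 0 = p 0 := by rw [← hg]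
    rw [this]; exact hp3
  refine ⟨g, hg3, fun g' hg' => ?_⟩
  rw [ModularGroup.im_smul_eq_div_normSq, ModularGroup.im_smul_eq_div_normSq,
    div_le_div_iff_of_pos_left]
  · have h' := hp (g' 1) ⟨ModularGroup.bottom_row_coprime g', (mem_Gamma0_three_iff g').mp hg'⟩
    simpa [← hg, ModularGroup.denom_apply] using h'
  · exact z.im_pos
  · exact UpperHalfPlane.normSq_denom_pos g' z.im_ne_zero
  · exact UpperHalfPlane.normSq_denom_pos g z.im_ne_zero

/-- A point of maximal height in the `Γ₀(3)⁺`-orbit. [folklore] -/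
theorem exists_max_im_orbThree (z : ℍ) : ∃ u ∈ orbThree z, ∀ v ∈ orbThree z, v.im ≤ u.im := by
  obtain ⟨g₁, hg₁, h₁⟩ := exists_max_im_Gamma0_three z
  obtain ⟨g₂, hg₂, h₂⟩ := exists_max_im_Gamma0_three (frickeThree z)
  rcases le_total (g₂ • frickeThree z).im (g₁ • z).im with h | h
  · refine ⟨g₁ • z, ⟨g₁, hg₁, Or.inl rfl⟩, ?_⟩
    rintro v ⟨γ, hγ, rfl | rfl⟩
    · exact h₁ γ hγ
    · exact (h₂ γ hγ).trans h
  · refine ⟨g₂ • frickeThree z, ⟨g₂, hg₂, Or.inr rfl⟩, ?_⟩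
    rintro v ⟨γ, hγ, rfl | rfl⟩
    · exact (h₁ γ hγ).trans h
    · exact h₂ γ hγ

/-- Integer translates lie in `Γ₀(3)`-orbits. [folklore] -/
theorem vadd_int_mem_orbThree (z : ℍ) (n : ℤ) : ((n : ℝ)) +ᵥ z ∈ orbThree z := by
  refine ⟨ModularGroup.T ^ n, ?_, Or.inl ?_⟩
  · rw [mem_Gamma0_three_iff, ModularGroup.coe_T_zpow]; simp
  · rw [UpperHalfPlane.modular_T_zpow_smul]

/-- **Every `Γ₀(3)⁺`-orbit meets `𝒟₃`.** [folklore] -/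
theorem exists_mem_orbThree_mem_fdThree (z : ℍ) : ∃ u ∈ orbThree z, u ∈ fdThree := by
  obtain ⟨u₀, hu₀, hmax⟩ := exists_max_im_orbThree z
  set n : ℤ := -⌊u₀.re + 1 / 2⌋ with hn
  set u : ℍ := ((n : ℝ)) +ᵥ u₀ with hu
  have hu_orb : u ∈ orbThree z := orbThree_subset_of_mem hu₀ (vadd_int_mem_orbThree u₀ n)
  have hu_im : u.im = u₀.im := by rw [hu, UpperHalfPlane.vadd_im]
  have hu_re : |u.re| ≤ 1 / 2 := by
    rw [hu, UpperHalfPlane.vadd_re, hn]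
    have h1 := Int.floor_le (u₀.re + 1 / 2)
    have h2 := Int.lt_floor_add_one (u₀.re + 1 / 2)
    rw [abs_le]; push_cast; constructor <;> linarith
  refine ⟨u, hu_orb, hu_re, ?_⟩
  have hW : (frickeThree u).im ≤ u.im := by
    rw [hu_im]
    exact hmax _ (orbThree_subset_of_mem hu_orb (frickeThree_mem_orbThree u))
  rw [im_frickeThree] at hW
  have hn0 : 0 < Complex.normSq (u : ℂ) := Complex.normSq_pos.mpr u.ne_zero
  rw [div_le_iff₀ (by positivity)] at hW
  nlinarith [u.im_pos]

/-- `W₃` maps the arc `|u|² = ⅓` to itself: `|W₃ u|² = 1/(9|u|²)`. [folklore] -/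
theorem normSq_frickeThree (u : ℍ) : Complex.normSq ((frickeThree u : ℍ) : ℂ) = 1 / (9 * Complex.normSq (u : ℂ)) := by
  have h3 : Complex.normSq (3 * (u : ℂ)) = 9 * Complex.normSq (u : ℂ) := by
    rw [Complex.normSq_mul]; simp [Complex.normSq_apply]; norm_num
  rw [coe_frickeThree, Complex.normSq_div, h3, Complex.normSq_neg, Complex.normSq_one]

end Literature.NumberTheory.ModularForms

end
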